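import Summits.BirchSwinnertonDyer.BirchSwinnertonDyer.Theorems.PrintCf2RamifiedOffTYZSelmerRankOneSixOfDisplays
import Summits.BirchSwinnertonDyer.BirchSwinnertonDyer.Theorems.PrintCf2RamifiedOffTYZSelmerRankOneOfFacts
import Summits.BirchSwinnertonDyer.Rank1Residual.P2.CongruentNumberGenusDoorsNoGZK
import Literature.NumberTheory.EllipticCurves.TianYuanZhang2017.CMPointFrobeniusFourDisplays
import Literature.NumberTheory.EllipticCurves.TianYuanZhang2017.CMPointRingClassDisplaysProofs
import HarnessLib

/-!
# Crux `PrintCf2.RamifiedOffTYZOfFacts` (stmt-BirchSwinnertonDyer-20509), line `offtyz-v7`, LEAD cycle 10 (cruxlead-20509 g9):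
# THE `s = 1`, `n ≡ 6 (mod 8)` STRATUM FROM THE NAMED FACTS (`tyz_cmPointRingClassFrobeniusFourData` ∧ `thm11_parity_of_scriptL`) — programme F3, part VI

THEOREMS ONLY (no `def`, no named fact, no `sorry`), `--supports stmt-BirchSwinnertonDyer-20509`; even companion of g7's `…SelmerRankOneOfFacts` (p694796)
and g8's `…SelmerRankOneSevenOfFacts` (p699569).  The display `Literature/…/TianYuanZhang2017/CMPointFrobeniusFourDisplays.lean` (p710393, this seat)
types the conductor-`4` Frobenius clause; with it the `n ≡ 6 (mod 8)` theorem of `…SelmerRankOneSixOfDisplays` becomes conditional on NAMED printed facts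
only, plus the one arithmetic hypothesis (class-number parities of the even blocks), plus `#Sel₂(E_n) = 8`:

  `rankOne_sha_bsdp_two_of_selmerEight_six_of_facts (hF : tyz_cmPointRingClassFrobeniusFourData) (h11 : thm11_parity_of_scriptL)
     (hsq : Squarefree n) (h6 : n % 8 = 6)
     (hgen : ∀ d ∈ n.divisors, d % 8 = 6 → (d = n ∨ ((n/d) % 8 = 1 ∧ #Sel₂(E_{n/d}) = 4)) → Odd (genusClassNumber (GenusField d)))
     (hsel : #Sel₂(E_n) = 8) : analyticRank E_n = 1 ∧ rank E_n(ℚ) = 1 ∧ Ш(E_n)[2^∞] = ⊥ ∧ BSDp E_n 2`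

and the isogeny-saturated form with conjuncts 1–3 of 𝔅_ram.  By the LEAD g8's census this is NEW coverage beyond Tian–Yuan–Zhang's Thm 1.2 (whose
`n ≡ 6 (8)` family is `Σ₂′` odd): ≈ 27 % of the `s = 1` stratum at `k ≤ 4` (union ≈ 80 %).  BSD is not proved by any of this; no class is closed by
this file (conditional results toward item 23432 `RamifiedOffJumpOneOfFacts`).

References: [cite: TianYuanZhang2017, Thm. 1.1, Thm. 1.2, §3.1, Prop. 3.2 (2), Thm. 3.5, Thm. 3.6 (2), Lemma 3.18, proof of Lemma 3.21];
[cite: Smith2016CongruentDensity, §2 Table 1, Thm. 1.2]; [cite: LiMa2008, Thm. 0.4]; [cite: HeathBrown1994SelmerCongruentII, Appendix (Monsky),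
typescript p. 39 L10 – p. 41 L36]; [cite: Cox2013, §5.C Lemma 5.19, (5.22), §9.A]; [cite: MilneADT2006, Thm. I.7.3]; [cite: Miller2011LMS, Def. 1.1].
-/

noncomputable section

open scoped Classical NumberField

open WeierstrassCurve WeierstrassCurve.Affine Finset Literature.NumberTheory.EllipticCurves
  Literature.NumberTheory.EllipticCurves.TianYuanZhang2017
  Literature.NumberTheory.EllipticCurves.HeathBrown1994
  Literature.NumberTheory.EllipticCurves.Rank1Residual
  Literature.NumberTheory.QuadraticFields.RingClass

set_option autoImplicit false

namespace Summit.BirchSwinnertonDyer.PrintCf2.MoverAssembly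

/-! ## §1 The conductor-`4` package refines the conductor-`2` package -/

/-- The conductor-`4` layer refines the conductor-`2` layer (drop the clause on the blocks `d ≡ 6 (mod 8)`).
[cite: TianYuanZhang2017, §3.1–3.2 and Prop. 3.2] -/
theorem cmPointRingClassFrobeniusPrinted_of_four {n : ℕ} (D : GenusPointData n) (h : D.CMPointRingClassFrobeniusFourPrinted) :
    D.CMPointRingClassFrobeniusPrinted := by
  obtain ⟨z, Φ, ΓH, ΓH', σ, θ, c, ρ₂, ρ₄, hc, hall⟩ := h
  exact ⟨z, Φ, ΓH, ΓH', σ, θ, c, ρ₂, ρ₄, hc, fun d hd =>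
    ⟨(hall d hd).1, (hall d hd).2.1, (hall d hd).2.2.1, (hall d hd).2.2.2.1, (hall d hd).2.2.2.2.1, (hall d hd).2.2.2.2.2.1⟩⟩

/-- **`tyz_cmPointRingClassFrobeniusFourData ⟹ tyz_cmPointRingClassFrobeniusData`** (hence also `tyz_cmPointRingClassData`, `tyz_genusPointData`):
the `n ≡ 5, 7 (mod 8)` theorems of the LEADs g7/g8 hold under the refined fact as well. [cite: TianYuanZhang2017, §3] -/
theorem tyz_cmPointRingClassFrobeniusData_of_four (h : tyz_cmPointRingClassFrobeniusFourData) : tyz_cmPointRingClassFrobeniusData := by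
  intro n hn h8
  obtain ⟨D, hD, hF⟩ := h n hn h8
  exact ⟨D, hD, cmPointRingClassFrobeniusPrinted_of_four D hF⟩

/-! ## §2 The `s = 1` stratum for `n ≡ 6 (mod 8)` from the named facts -/

/-- **THE MINIMAL-SELMER CASE AT `p = 2` FOR `n ≡ 6 (mod 8)`, mover sector, from the named facts.**  Granted Tian–Yuan–Zhang 2017 §3 as printed with the
Frobenius elements of the ramified odd primes on both kinds of blocks (`tyz_cmPointRingClassFrobeniusFourData`) and TYZ Thm 1.1 (`thm11_parity_of_scriptL`):
for every square-free `n ≡ 6 (mod 8)` with `#Sel⁽²⁾(E_n/ℚ) = 8` such that `g(d) = #2Cl(ℚ(√−d))` is ODD for every divisor `d ≡ 6 (mod 8)` of `n` with `d = n`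
or (`n/d ≡ 1 (mod 8)` and `#Sel⁽²⁾(E_{n/d}/ℚ) = 4`): `ord_{s=1} L(E_n, s) = 1`, `rank E_n(ℚ) = 1`, `Ш(E_n/ℚ)[2^∞] = 0` and `BSD(E_n, 2)`.
[cite: TianYuanZhang2017, Thm. 1.1 and §3 (Prop. 3.2 (2), Thm. 3.5, Thm. 3.6 (2), Lemma 3.18, proof of Lemma 3.21)]
[cite: HeathBrown1994SelmerCongruentII, Appendix (Monsky), typescript p. 41 L20–L36] [cite: Smith2016CongruentDensity, §2 Table 1, Thm. 1.2]
[cite: LiMa2008, Thm. 0.4] [cite: Miller2011LMS, Def. 1.1] -/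
theorem rankOne_sha_bsdp_two_of_selmerEight_six_of_facts (hF : tyz_cmPointRingClassFrobeniusFourData) (h11 : thm11_parity_of_scriptL)
    {n : ℕ} (hsq : Squarefree n) (h6 : n % 8 = 6)
    (hgen : ∀ d ∈ n.divisors, d % 8 = 6 → (d = n ∨ ((n / d) % 8 = 1 ∧ Nat.card ((congruentNumberCurve (n / d)).selmerGroup 2) = 4)) →
      Odd (genusClassNumber (GenusField d)))
    (hsel : haveI := isElliptic_congruentNumberCurve hsq.ne_zero; Nat.card ((congruentNumberCurve n).selmerGroup 2) = 8) :
    haveI := isElliptic_congruentNumberCurve hsq.ne_zero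
    (congruentNumberCurve n).analyticRank = 1 ∧ (congruentNumberCurve n).mordellWeilRank = 1 ∧
      AddCommGroup.primaryComponent (congruentNumberCurve n).sha 2 = ⊥ ∧ BSDp (congruentNumberCurve n) 2 := by
  obtain ⟨D, hPr, hCM⟩ := hF n hsq (Or.inr (Or.inl h6))
  exact rankOne_sha_bsdp_two_of_selmerEight_six_of_displays hsq h6 D hPr hCM h11 hgen hsel

/-- **`OfFacts` shape for the planner**: the conjunction of the two printed facts implies, for every square-free `n ≡ 6 (mod 8)` with `#Sel₂(E_n) = 8` and
the class-number parities of the even blocks, `ord = rank = 1`, `Ш[2^∞] = 0` and BSD(E_n, 2). [cite: TianYuanZhang2017, Thm. 1.1 and §3] [cite: Miller2011LMS, Def. 1.1] -/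
theorem selmerEight_mod_eight_six_bsdp_two_of_facts :
    (tyz_cmPointRingClassFrobeniusFourData ∧ thm11_parity_of_scriptL) →
      ∀ n : ℕ, (hsq : Squarefree n) → n % 8 = 6 →
        (∀ d ∈ n.divisors, d % 8 = 6 → (d = n ∨ ((n / d) % 8 = 1 ∧ Nat.card ((congruentNumberCurve (n / d)).selmerGroup 2) = 4)) →
          Odd (genusClassNumber (GenusField d))) →
        (haveI := isElliptic_congruentNumberCurve hsq.ne_zero; Nat.card ((congruentNumberCurve n).selmerGroup 2) = 8) →
        haveI := isElliptic_congruentNumberCurve hsq.ne_zero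
        (congruentNumberCurve n).analyticRank = 1 ∧ (congruentNumberCurve n).mordellWeilRank = 1 ∧
          AddCommGroup.primaryComponent (congruentNumberCurve n).sha 2 = ⊥ ∧ BSDp (congruentNumberCurve n) 2 :=
  fun h _ hsq h6 hgen hsel => rankOne_sha_bsdp_two_of_selmerEight_six_of_facts h.1 h.2 hsq h6 hgen hsel

/-! ## §3 Isogeny saturation from the named facts (conjuncts 1–3 of 𝔅_ram) -/

/-- **`BSD(W, 2)` for every globally minimal `W/ℚ` isogenous to such a minimal-Selmer `E_n`, `n ≡ 6 (mod 8)`**, granted the two printed TYZ facts and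
conjuncts 1–3 of the route's bundle 𝔅_ram (GZK, entire `L`, Cassels). [cite: MilneADT2006, Thm. I.7.3] [cite: TianYuanZhang2017, Thm. 1.1 and §3] [cite: Miller2011LMS, Def. 1.1] -/
theorem bsdp_two_of_isIsogenous_selmerEight_mod_eight_six (hF : tyz_cmPointRingClassFrobeniusFourData) (h11 : thm11_parity_of_scriptL)
    (hGZK : rank_eq_analyticRank_of_analyticRank_le_one) (hL : hasEntireLFunction_rat) (hCassels : bsdRHS_eq_of_isIsogenous)
    {W : WeierstrassCurve ℚ} [W.IsElliptic] [W.IsGloballyMinimal]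
    {n : ℕ} (hsq : Squarefree n) (h6 : n % 8 = 6)
    (hgen : ∀ d ∈ n.divisors, d % 8 = 6 → (d = n ∨ ((n / d) % 8 = 1 ∧ Nat.card ((congruentNumberCurve (n / d)).selmerGroup 2) = 4)) →
      Odd (genusClassNumber (GenusField d)))
    (hsel : haveI := isElliptic_congruentNumberCurve hsq.ne_zero; Nat.card ((congruentNumberCurve n).selmerGroup 2) = 8)
    (hiso : IsIsogenous W (congruentNumberCurve n)) : BSDp W 2 := by
  obtain ⟨D, hPr, hCM⟩ := hF n hsq (Or.inr (Or.inl h6))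
  exact bsdp_two_of_isIsogenous_selmerEight_six_of_displays hGZK hL hCassels hsq h6 D hPr hCM h11 hgen hsel hiso

/-! ## §4 Union with Tian–Yuan–Zhang's Thm 1.2 criterion for `n ≡ 6 (mod 8)` -/

/-- **THE `s = 1` STRATUM FOR `n ≡ 6 (mod 8)`: TYZ's criterion OR the mover criterion**, from the named facts.  For square-free `n ≡ 6 (mod 8)` with
`#Sel⁽²⁾(E_n/ℚ) = 8`: if `Σ₂′(n)` is odd (Tian–Yuan–Zhang Thm 1.2, through the tree's genus door modulo `tyz_genusPointData`, which the displayed fact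
refines) OR the class-number parities of the even blocks hold (this file's mover theorem), then `ord_{s=1} L(E_n,s) = rank E_n(ℚ) = 1`, `Ш(E_n)[2^∞] = 0`,
`BSD(E_n, 2)`.  (LEAD g8 census, `Lines/offtyz_v7_SevenSector.md` §9: the two criteria together cover ≈ 80 % of the `s = 1` stratum at `k ≤ 4`.)
[cite: TianYuanZhang2017, Thm. 1.1, Thm. 1.2 and §3] [cite: Smith2016CongruentDensity, §2 Table 1, Thm. 1.2] [cite: Miller2011LMS, Def. 1.1] -/
theorem rankOne_sha_bsdp_two_of_selmerEight_six_union_of_facts (hF : tyz_cmPointRingClassFrobeniusFourData) (h11 : thm11_parity_of_scriptL)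
    {n : ℕ} (hsq : Squarefree n) (h6 : n % 8 = 6)
    (hor : Odd (genusSum₂' n fun d => genusClassNumber (GenusField d)) ∨
      ∀ d ∈ n.divisors, d % 8 = 6 → (d = n ∨ ((n / d) % 8 = 1 ∧ Nat.card ((congruentNumberCurve (n / d)).selmerGroup 2) = 4)) →
        Odd (genusClassNumber (GenusField d)))
    (hsel : haveI := isElliptic_congruentNumberCurve hsq.ne_zero; Nat.card ((congruentNumberCurve n).selmerGroup 2) = 8) :
    haveI := isElliptic_congruentNumberCurve hsq.ne_zero
    (congruentNumberCurve n).analyticRank = 1 ∧ (congruentNumberCurve n).mordellWeilRank = 1 ∧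
      AddCommGroup.primaryComponent (congruentNumberCurve n).sha 2 = ⊥ ∧ BSDp (congruentNumberCurve n) 2 := by
  rcases hor with hodd | hgen
  · have hTYZ : tyz_genusPointData :=
      tyz_genusPointData_of_cmPointRingClassData (tyz_cmPointRingClassData_of_frobeniusData (tyz_cmPointRingClassFrobeniusData_of_four hF))
    exact Rank1Residual.P2.rankOne_sha_bsdp_two_congruentNumberCurve_of_selmerEight_six_noGZK hTYZ hsq h6 hsel hodd
  · exact rankOne_sha_bsdp_two_of_selmerEight_six_of_facts hF h11 hsq h6 hgen hsel

end Summit.BirchSwinnertonDyer.PrintCf2.MoverAssembly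

end
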